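import Literature.AlgebraicGeometry.Resolution.DChartHensel
import Literature.AlgebraicGeometry.Resolution.EChart
import Mathlib.FieldTheory.PurelyInseparable.Basic
import HarnessLib

/-!
# The chart datum of Thm. 3.3.1 — III/IV. The E-data, the two charts inside `Ω`, the roof, the conclusion

Topic: `Literature/AlgebraicGeometry/Resolution`. M. Temkin, *Inseparable local uniformization*,
J. Algebra 373 (2013) = arXiv:0804.1554v3, Thm. 3.3.1, smooth-fibre case (tree:
`Temkin2013RelativeCurveSmoothFibre`), proof, Steps 3–4 ("`X̄′ = V ×_Y Ȳ … X″ = V ×_Y Y′ → Y′` is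
étale … `Y′` is `m°`-smooth at the image of `x″`"). For a chart datum `C : RelCurveChart k K L₁ Ω`
and E-DATA `E : EData C` — the local-étale description of `L₁°m°` over the disc chart `m°[x′]`
(Hensel root `η`, standard-étale data over the disc chart `m°[x′][1/u]`, normal forms of the
finitely many elements that must become regular, fraction forms) — we build

* the `K`-side chart `TA = T[1/u] ⊇ N″` (`T` from `DChartHensel.lean`, `u` the unit of the
  disc chart): smooth over `N = Nr_{L₁}(A′)`, normal, containing `η` — PROVED;
* the `m°`-side chart `TB` (`EChart.lean`) — and the two inclusions `TB ⊆ TA[1/s_A]`,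
  `TA ⊆ TB[1/s_B]` with `V`-units `s_A, s_B` — PROVED;
* the roof (Part IV): `RelCurveChart.areSmoothEquivalent` —
  `AreSmoothEquivalent (k° → N) (k° → m°) 𝔭_V 𝔮_V` by `AreSmoothEquivalent.of_charts`
  (`RoofInField.lean`) — PROVED;
* `RelCurveChart.conclusion` — `Temkin2013RelativeCurveConclusion k K k° K° A L₁ L₁°` for the
  datum (trivial purely inseparable extensions, `m = k(y₀)`, `N = Nr_{L₁}(A′)`) — PROVED;
* `Temkin2013RelativeCurveSmoothFibre.of_chartData` — the named fact REDUCED to the existence of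
  chart data with E-data for every instance of its hypotheses — PROVED;
* `Algebra.Smooth.of_ringEquiv_base` — bookkeeping — PROVED.

Everything is [folklore] bookkeeping over the cited files; no named facts.

## Sources

* M. Temkin, arXiv:0804.1554v3, proof of Thm. 3.3.1, Steps 3–4 (p. 45).
-/

noncomputable section

open Polynomial IsLocalRing

namespace Literature.AlgebraicGeometry.Resolution

universe u

section Generic

variable {Ω : Type u} [Field Ω]

/-- **Membership from integrality and a fraction form, for a normal chart realized in `Ω`.**
[folklore] -/
theorem mem_of_isIntegral_of_mul_mem {R : Type u} [CommRing R] [Algebra R Ω] (T : Subalgebra R Ω)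
    [IsIntegrallyClosed T] {z : Ω} (hz : IsIntegral T z) {u : Ω} (huT : u ∈ T) (hu0 : u ≠ 0)
    (huz : u * z ∈ T) : z ∈ T := by
  haveI : IsDomain T := Function.Injective.isDomain (algebraMap T Ω) Subtype.val_injective
  let Kf := FractionRing T
  have hinj : Function.Injective (algebraMap T Ω) := Subtype.val_injective
  let φ : Kf →+* Ω := IsFractionRing.lift hinj
  have hφalg : ∀ t : T, φ (algebraMap T Kf t) = (t : Ω) := fun t => IsFractionRing.lift_algebraMap hinj t
  have hu' : (⟨u, huT⟩ : T) ∈ nonZeroDivisors T :=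
    mem_nonZeroDivisors_of_ne_zero fun h0 => hu0 (congrArg Subtype.val h0)
  set xK : Kf := IsLocalization.mk' Kf (⟨u * z, huz⟩ : T) ⟨⟨u, huT⟩, hu'⟩ with hxK
  have hφx : φ xK = z := by
    have h1 : xK * algebraMap T Kf ⟨u, huT⟩ = algebraMap T Kf ⟨u * z, huz⟩ := IsLocalization.mk'_spec Kf _ _
    have h2 := congrArg φ h1
    rw [map_mul, hφalg, hφalg] at h2
    -- `φ xK * u = u * z`
    have h3 : φ xK * u = z * u := by rw [h2]; exact mul_comm u z
    exact mul_right_cancel₀ hu0 h3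
  have hxint : IsIntegral T xK := by
    obtain ⟨p, hpm, hpz⟩ := hz
    refine ⟨p, hpm, ?_⟩
    apply φ.injective
    rw [Polynomial.hom_eval₂, map_zero]
    have hcomp : φ.comp (algebraMap T Kf) = algebraMap T Ω := RingHom.ext fun t => hφalg t
    rw [hcomp, hφx]
    exact hpz
  obtain ⟨y, hy⟩ := (IsIntegrallyClosed.isIntegral_iff (R := T) (K := Kf)).mp hxint
  have : (y : Ω) = z := by rw [← hφalg, hy, hφx]
  rw [← this]
  exact y.2

end Generic

namespace RelCurveChart

variable {k K L₁ Ω : Type u} [Field k] [Field K] [Field L₁] [Field Ω]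
  [Algebra k K] [Algebra K L₁] [Algebra k L₁] [IsScalarTower k K L₁]
  [Algebra L₁ Ω] [Algebra K Ω] [Algebra k Ω] [IsScalarTower K L₁ Ω] [IsScalarTower k L₁ Ω]
  [IsAlgClosed Ω] [FiniteDimensional K L₁] (C : RelCurveChart k K L₁ Ω)

/-- The base ring of the `m`-side: `m° = O_V ∩ m` as a subring of `Ω`. [folklore] -/
def Om : Subring Ω := C.V.toSubring ⊓ C.m.toSubring

/-- Membership in `m°`. [folklore] -/
theorem mem_Om_iff {z : Ω} : z ∈ C.Om ↔ z ∈ C.V ∧ z ∈ C.m := Subring.mem_inf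

/-- **The E-data of a chart datum**: the local-étale description of `L₁°m°` over the disc
chart `m°[x′][1/u]` (`u ∈ m°[x′]` a `V`-unit — the product of the Kaplansky unit forms of the
denominators): `η` a Hensel root generating `L₁m` over `m(x)` with standard-étale data
`f, g, h, p₂, s` with coefficients in the disc chart, `f` of least degree over `m(x)`; `ZE`
finitely many elements with normal forms `a_z(η)/(b_z(η) g(η)ᵏ)` over the disc chart, among
them the images of the model generators `s_A, s_fine`, the unit `f`, the zoomed root `z₀` and the
co-unit `w₀` of the Hensel chart, the `K`-rational cut-out function `g_K` and the sheet cutter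
`b`; fraction forms over `m°[x′][η]` for the elements of `L₁` (`L₁ ⊆ m(x)(η)`); `η ∈ L₁(y₀)`; and
`x′` transcendental over `m°`. [cite: Temkin2013, Thm. 3.3.1 (proof, Steps 2–3)] -/
structure EData where
  /-- The `V`-unit `u ∈ m°[x′]` inverted on the disc chart (product of the Kaplansky unit forms
  of the finitely many denominators). -/
  u : Ω
  hu : u ∈ Algebra.adjoin C.Om ({C.x'} : Set Ω)
  hvu : C.V.valuation u = 1
  /-- The Hensel root and its standard-étale data. -/
  η : Ω
  hηV : η ∈ C.V
  f : Polynomial Ω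
  g : Polynomial Ω
  h : Polynomial Ω
  p₂ : Polynomial Ω
  s : ℕ
  hfmon : f.Monic
  hfη : f.eval η = 0
  hcoef : ∀ Q ∈ ({f, g, h, p₂} : Set (Polynomial Ω)), ∀ i,
    Q.coeff i ∈ locAway (Algebra.adjoin C.Om ({C.x'} : Set Ω)) u hu
  hfmin : ∀ Q : Polynomial Ω, (∀ i, Q.coeff i ∈ Subfield.closure ((C.m : Set Ω) ∪ {C.xΩ})) →
    Q ≠ 0 → Q.eval η = 0 → f.natDegree ≤ Q.natDegree
  hident : derivative f * h + f * p₂ = g ^ s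
  hvg : C.V.valuation (g.eval η) = 1
  /-- The elements to be made regular on the `m°`-side, with their normal forms. -/
  ZE : Finset Ω
  hZE : ∀ z ∈ ZE, ∃ (az bz : Polynomial Ω) (k : ℕ),
    (∀ j, az.coeff j ∈ locAway (Algebra.adjoin C.Om ({C.x'} : Set Ω)) u hu ∧
      bz.coeff j ∈ locAway (Algebra.adjoin C.Om ({C.x'} : Set Ω)) u hu) ∧
    C.V.valuation (bz.eval η) = 1 ∧ z = az.eval η / (bz.eval η * g.eval η ^ k)
  hsA : ∀ z ∈ C.sA, algebraMap K Ω z ∈ ZE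
  hsfine : ∀ z ∈ C.sfine, algebraMap K Ω z ∈ ZE
  hfZE : C.fΩ ∈ ZE
  hz₀ : C.z₀ ∈ ZE
  hw₀ : C.w₀ ∈ ZE
  /-- The `K`-rational cut-out function and the sheet cutter are regular on the disc chart. -/
  hgKZE : algebraMap K Ω C.gK ∈ ZE
  hbZE : C.b ∈ ZE
  /-- Fraction forms: `L₁ ⊆ Frac(m°[x′][η])` explicitly. -/
  hfrac : ∀ z : L₁, ∃ (u : Ω) (t : Polynomial Ω), u ∈ Algebra.adjoin C.Om ({C.x'} : Set Ω) ∧ u ≠ 0 ∧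
    (∀ i, t.coeff i ∈ Algebra.adjoin C.Om ({C.x'} : Set Ω)) ∧ u * algebraMap L₁ Ω z = t.eval η
  /-- `η ∈ L₁[y₀]`. -/
  hηL₁ : ∃ t : Polynomial Ω, (∀ i, t.coeff i ∈ (algebraMap L₁ Ω).fieldRange) ∧ η = t.eval C.y₀
  /-- `x′` is transcendental over `m°`. -/
  htr : Transcendental C.Om C.x'

variable {C} (E : EData C)

/-! ### The `K`-side chart `TA = T[1/u]` -/

/-- `m° ⊆ T`. [folklore] -/
theorem mem_T_of_mem_Om {z : Ω} (hz : z ∈ C.Om) : z ∈ C.T :=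
  C.T₁_le_T (C.mem_T₁_of_mem_m (C.mem_Om_iff.mp hz).2 (C.mem_Om_iff.mp hz).1)

/-- A polynomial over `m°` evaluated at `x′` lies in `T`. [folklore] -/
theorem eval_mem_T_of_coeff_mem_Om {q : Polynomial Ω} (hq : ∀ i, q.coeff i ∈ C.Om) : q.eval C.x' ∈ C.T := by
  rw [Polynomial.eval_eq_sum_range]
  exact C.T.sum_mem fun i _ => C.T.mul_mem (mem_T_of_mem_Om (hq i)) (C.T.pow_mem C.x'_mem_T i)

namespace EData

/-- `T` as an `m°`-subalgebra of `Ω`. [folklore] -/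
def TOm : Subalgebra C.Om Ω :=
  { C.T.toSubring with
    algebraMap_mem' := fun c => mem_T_of_mem_Om c.2 }

/-- `m°[x′] ⊆ T`. [folklore] -/
theorem adjoin_x'_le_TOm : Algebra.adjoin C.Om ({C.x'} : Set Ω) ≤ TOm (C := C) :=
  Algebra.adjoin_le (Set.singleton_subset_iff.mpr C.x'_mem_T)

/-- The inverted unit, under the name used below. [folklore] -/
def uA : Ω := E.u

/-- `u ∈ T`. [folklore] -/
theorem uA_mem_T : E.uA ∈ C.T := adjoin_x'_le_TOm (C := C) E.hu

/-- `|u| = 1`. [folklore] -/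
theorem valuation_uA : C.V.valuation E.uA = 1 := E.hvu

/-- `u ≠ 0`. [folklore] -/
theorem uA_ne_zero : E.uA ≠ 0 := fun h0 => by
  have h := E.valuation_uA; rw [h0, map_zero] at h; exact zero_ne_one h

/-- **The `K`-side chart `TA = T[1/u]`.** [folklore] -/
def TA : Subalgebra C.N'' Ω := locAway C.T E.uA E.uA_mem_T

/-- `T ≤ TA`. [folklore] -/
theorem T_le_TA : C.T ≤ E.TA := le_locAway

/-- `TA` is étale over `R = N″`. [folklore] -/
theorem etale_TA : Algebra.Etale C.N'' E.TA := by
  haveI := C.etale_T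
  exact etale_locAway_of_etale E.uA_ne_zero

/-- `TA ⊆ O_V`. [folklore] -/
theorem TA_le_V : E.TA.toSubring ≤ C.V.toSubring := locAway_le_valuationSubring C.T_le_V E.valuation_uA

/-- `TA` is an integrally closed domain. [folklore] -/
theorem isIntegrallyClosed_TA : IsIntegrallyClosed E.TA := by
  haveI := E.etale_TA
  haveI : IsIntegrallyClosed C.N'' := C.isIntegrallyClosed_N''
  exact isIntegrallyClosed_of_etale (R := C.N'') (T := E.TA) fun a b hab => Subtype.ext (by
    have := congrArg (fun w : E.TA => (w : Ω)) hab
    exact this)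

/-- **The disc chart `m°[x′][1/u]` lies in `TA`.** [folklore] -/
theorem mem_TA_of_mem_locAway {q : Ω}
    (hq : q ∈ locAway (Algebra.adjoin C.Om ({C.x'} : Set Ω)) E.u E.hu) : q ∈ E.TA := by
  obtain ⟨n, hn⟩ := (mem_locAway_iff (hf := E.hu)).mp hq
  exact (mem_locAway_iff (hf := E.uA_mem_T)).mpr ⟨n, adjoin_x'_le_TOm (C := C) hn⟩

/-! ### `η ∈ TA` -/

/-- Common `N`-denominators for finitely many elements of `L₁ = Frac N`. [folklore] -/
theorem exists_mul_mem_N (S : Finset L₁) : ∃ n ∈ C.N, n ≠ 0 ∧ ∀ z ∈ S, n * z ∈ C.N := by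
  classical
  induction S using Finset.induction_on with
  | empty => exact ⟨1, C.N.one_mem, one_ne_zero, fun z hz => absurd hz (Finset.notMem_empty z)⟩
  | @insert w S hw ih =>
    obtain ⟨n, hnN, hn0, hnS⟩ := ih
    obtain ⟨a, ha, b, hb, hb0, hw'⟩ := C.exists_div_N w
    refine ⟨n * b, C.N.mul_mem hnN hb, mul_ne_zero hn0 hb0, fun z hz => ?_⟩
    rcases Finset.mem_insert.mp hz with rfl | hz
    · rw [hw', mul_assoc, mul_div_cancel₀ _ hb0]
      exact C.N.mul_mem hnN ha
    · rw [mul_comm n b, mul_assoc]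
      exact C.N.mul_mem hb (hnS z hz)

/-- `N ⊆ TA` (through `N″ ⊆ T`). [folklore] -/
theorem algebraMap_mem_TA {w : L₁} (hw : w ∈ C.N) : algebraMap L₁ Ω w ∈ E.TA :=
  E.T_le_TA (C.T₁_le_T (C.T₀_le_T₁ (C.T₀.algebraMap_mem ⟨_, C.algebraMap_mem_N'' hw⟩)))

/-- `y₀ ∈ TA`. [folklore] -/
theorem y₀_mem_TA : C.y₀ ∈ E.TA := E.T_le_TA (C.T₁_le_T (C.T₀_le_T₁ C.y₀_mem_T₀))

/-- A fraction form for `η` over `TA`: `n η ∈ TA` for some `n ∈ N ∖ 0`. [folklore] -/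
theorem exists_mul_eta_mem_TA : ∃ n ∈ C.N, n ≠ 0 ∧ algebraMap L₁ Ω n * E.η ∈ E.TA := by
  classical
  obtain ⟨t, ht, hη⟩ := E.hηL₁
  choose ℓ hℓ using fun i => ht i
  obtain ⟨n, hnN, hn0, hnS⟩ :=
    exists_mul_mem_N (C := C) ((Finset.range (t.natDegree + 1)).image ℓ)
  refine ⟨n, hnN, hn0, ?_⟩
  rw [hη, Polynomial.eval_eq_sum_range, Finset.mul_sum]
  refine E.TA.sum_mem fun i hi => ?_
  rw [← mul_assoc, ← hℓ i, ← map_mul]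
  exact E.TA.mul_mem (E.algebraMap_mem_TA (hnS _ (Finset.mem_image_of_mem ℓ hi)))
    (E.TA.pow_mem E.y₀_mem_TA i)

/-- `η` is integral over `TA` (the monic `f` has its coefficients in `TA`). [folklore] -/
theorem isIntegral_eta : IsIntegral E.TA E.η := by
  have hl : E.f ∈ Polynomial.lifts (algebraMap E.TA Ω) := by
    refine (Polynomial.lifts_iff_coeff_lifts _).mpr fun i => ?_
    exact ⟨⟨E.f.coeff i, E.mem_TA_of_mem_locAway (E.hcoef E.f (by simp) i)⟩, rfl⟩
  obtain ⟨fT, hfT, -, hfTmon⟩ := Polynomial.lifts_and_degree_eq_and_monic hl E.hfmon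
  refine ⟨fT, hfTmon, ?_⟩
  rw [← Polynomial.eval_map, hfT]
  exact E.hfη

/-- **`η ∈ TA`** (normality of `TA`). [folklore] -/
theorem eta_mem_TA : E.η ∈ E.TA := by
  haveI := E.isIntegrallyClosed_TA
  obtain ⟨n, hnN, hn0, hn⟩ := E.exists_mul_eta_mem_TA
  exact mem_of_isIntegral_of_mul_mem E.TA E.isIntegral_eta (E.algebraMap_mem_TA hnN)
    ((_root_.map_ne_zero _).mpr hn0) hn

/-! ### The `m°`-side chart `TB` and `TB ⊆ TA[1/D]` -/

/-- The E-chart exists for the data of `E` (an instance of `exists_EChart`). [folklore] -/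
theorem exists_TB : ∃ (T : Subalgebra C.Om Ω), Algebra.Smooth C.Om T ∧ IsIntegrallyClosed T ∧
    T.toSubring ≤ C.V.toSubring ∧ C.x' ∈ T ∧ E.η ∈ T ∧ (∀ z ∈ E.ZE, z ∈ T) ∧
    ∃ D ∈ Algebra.adjoin C.Om ({C.x', E.η} : Set Ω), C.V.valuation D = 1 ∧ ∀ w ∈ T, ∃ N : ℕ,
      w * D ^ N ∈ Algebra.adjoin C.Om ({C.x', E.η} : Set Ω) :=
  exists_EChart C.V C.m C.hΔ E.htr E.hu E.hvu E.hηV E.f E.g E.h E.p₂ E.s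
    E.hfmon E.hfη E.hcoef E.hfmin E.hident E.hvg C.ham C.hcm E.ZE E.hZE

/-- **The `m°`-side chart `TB`.** [folklore] -/
def TB : Subalgebra C.Om Ω := E.exists_TB.choose

/-- `TB` is smooth over `m°`. [folklore] -/
theorem smooth_TB : Algebra.Smooth C.Om E.TB := E.exists_TB.choose_spec.1

/-- `TB` is an integrally closed domain. [folklore] -/
theorem isIntegrallyClosed_TB : IsIntegrallyClosed E.TB := E.exists_TB.choose_spec.2.1

/-- `TB ⊆ O_V`. [folklore] -/
theorem TB_le_V : E.TB.toSubring ≤ C.V.toSubring := E.exists_TB.choose_spec.2.2.1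

/-- `x′ ∈ TB`. [folklore] -/
theorem x'_mem_TB : C.x' ∈ E.TB := E.exists_TB.choose_spec.2.2.2.1

/-- `η ∈ TB`. [folklore] -/
theorem eta_mem_TB : E.η ∈ E.TB := E.exists_TB.choose_spec.2.2.2.2.1

/-- `ZE ⊆ TB`. [folklore] -/
theorem mem_TB_of_mem_ZE {z : Ω} (hz : z ∈ E.ZE) : z ∈ E.TB := E.exists_TB.choose_spec.2.2.2.2.2.1 z hz

/-- The export unit `D` of `TB`. [folklore] -/
def D : Ω := E.exists_TB.choose_spec.2.2.2.2.2.2.choose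

/-- `D ∈ m°[x′, η]`. [folklore] -/
theorem D_mem_adjoin : E.D ∈ Algebra.adjoin C.Om ({C.x', E.η} : Set Ω) :=
  E.exists_TB.choose_spec.2.2.2.2.2.2.choose_spec.1

/-- `D ∈ TB`. [folklore] -/
theorem D_mem_TB : E.D ∈ E.TB := by
  refine (Algebra.adjoin_le ?_ : Algebra.adjoin C.Om ({C.x', E.η} : Set Ω) ≤ E.TB) E.D_mem_adjoin
  rintro w (rfl | rfl)
  · exact E.x'_mem_TB
  · exact E.eta_mem_TB

/-- `|D| = 1`. [folklore] -/
theorem valuation_D : C.V.valuation E.D = 1 := E.exists_TB.choose_spec.2.2.2.2.2.2.choose_spec.2.1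

/-- The normal-form export of `TB`. [folklore] -/
theorem TB_export {w : Ω} (hw : w ∈ E.TB) :
    ∃ N : ℕ, w * E.D ^ N ∈ Algebra.adjoin C.Om ({C.x', E.η} : Set Ω) :=
  E.exists_TB.choose_spec.2.2.2.2.2.2.choose_spec.2.2 w hw

/-- `m° ⊆ TB`. [folklore] -/
theorem mem_TB_of_mem_Om {z : Ω} (hz : z ∈ C.Om) : z ∈ E.TB := E.TB.algebraMap_mem ⟨z, hz⟩

/-- `TA` as an `m°`-subalgebra of `Ω`. [folklore] -/
def TAOm : Subalgebra C.Om Ω :=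
  { E.TA.toSubring with
    algebraMap_mem' := fun c => E.T_le_TA (mem_T_of_mem_Om c.2) }

/-- Membership in `TAOm` is membership in `TA`. [folklore] -/
theorem mem_TAOm_iff {w : Ω} : w ∈ E.TAOm ↔ w ∈ E.TA := Iff.rfl

/-- `m°[x′, η] ⊆ TA`. [folklore] -/
theorem adjoin_le_TAOm : Algebra.adjoin C.Om ({C.x', E.η} : Set Ω) ≤ E.TAOm := by
  refine Algebra.adjoin_le ?_
  rintro w (rfl | rfl)
  · exact E.T_le_TA C.x'_mem_T
  · exact E.eta_mem_TA

/-- `D ∈ TA`. [folklore] -/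
theorem D_mem_TA : E.D ∈ E.TA := E.adjoin_le_TAOm E.D_mem_adjoin

/-- `D ≠ 0`. [folklore] -/
theorem D_ne_zero : E.D ≠ 0 := fun h0 => by
  have h := E.valuation_D; rw [h0, map_zero] at h; exact zero_ne_one h

/-- **`TB ⊆ TA[1/D]`.** [folklore] -/
theorem TB_subset_locAway_TA : (E.TB : Set Ω) ⊆ locAway E.TA E.D E.D_mem_TA := by
  intro w hw
  obtain ⟨N, hN⟩ := E.TB_export hw
  exact (mem_locAway_iff (hf := E.D_mem_TA)).mpr ⟨N, E.adjoin_le_TAOm hN⟩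

/-! ### `TA ⊆ TB[1/s_B]` -/

/-- A polynomial over `m°` in `x′` lies in `TB`. [folklore] -/
theorem eval_mem_TB_of_coeff_mem_Om {q : Polynomial Ω} (hq : ∀ i, q.coeff i ∈ C.Om) :
    q.eval C.x' ∈ E.TB := by
  rw [Polynomial.eval_eq_sum_range]
  exact E.TB.sum_mem fun i _ => E.TB.mul_mem (E.mem_TB_of_mem_Om (hq i)) (E.TB.pow_mem E.x'_mem_TB i)


/-- `g_K ∈ TB` (the cut-out function is regular on the disc chart: `g_K ∈ ZE`). [folklore] -/
theorem gK_mem_TB : algebraMap K Ω C.gK ∈ E.TB := E.mem_TB_of_mem_ZE E.hgKZE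

/-- `b ∈ TB` (`b ∈ ZE`). [folklore] -/
theorem b_mem_TB : C.b ∈ E.TB := E.mem_TB_of_mem_ZE E.hbZE

/-- `u ∈ TB`. [folklore] -/
theorem uA_mem_TB : E.uA ∈ E.TB :=
  (Algebra.adjoin_le (Set.singleton_subset_iff.mpr E.x'_mem_TB) :
    Algebra.adjoin C.Om ({C.x'} : Set Ω) ≤ E.TB) E.hu

/-- `μ ∈ TB`. [folklore] -/
theorem μ_mem_TB : C.μ ∈ E.TB :=
  E.mem_TB_of_mem_Om (C.mem_Om_iff.mpr ⟨(C.V.valuation_le_one_iff _).mp C.valuation_μ.le, C.μ_mem_m⟩)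

/-- `k° ⊆ TB`. [folklore] -/
theorem algebraMap_mem_TB_of_mem_Ok {c₀ : k} (hc₀ : c₀ ∈ C.Ok) : algebraMap k Ω c₀ ∈ E.TB := by
  refine E.mem_TB_of_mem_Om (C.mem_Om_iff.mpr ⟨?_, C.kΩ_le_m ⟨c₀, rfl⟩⟩)
  have : c₀ ∈ C.V.comap (algebraMap k Ω) := by rw [C.comap_k]; exact hc₀
  exact this

/-- **`N ⊆ W` for every valuation ring `W ⊇ TB`** (`N` is integral over `k°[s_A, s_fine, g_K]`,
which lies in `TB`). [folklore] -/
theorem algebraMap_mem_of_mem_N_of_le {W : ValuationSubring Ω} (hW : E.TB.toSubring ≤ W.toSubring)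
    {z : L₁} (hz : z ∈ C.N) : algebraMap L₁ Ω z ∈ W := by
  -- `A′ ⊆ W ∩ K`
  have hA'W : C.A' ≤ (W.comap (algebraMap K Ω)).toSubring := by
    intro a ha
    refine mem_valuationSubring_of_isIntegral_subring (W.comap (algebraMap K Ω)) ?_ (mem_nrIn_iff.mp ha)
    refine Subring.closure_le.mpr ?_
    rintro w (⟨c₀, hc₀, rfl⟩ | hw)
    · change algebraMap K Ω (algebraMap k K c₀) ∈ W
      rw [IsScalarTower.algebraMap_apply K L₁ Ω, ← IsScalarTower.algebraMap_apply k K L₁,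
        ← IsScalarTower.algebraMap_apply k L₁ Ω]
      exact hW (E.algebraMap_mem_TB_of_mem_Ok hc₀)
    · change algebraMap K Ω w ∈ W
      rcases C.mem_sAll_iff.mp hw with h | h | rfl
      · exact hW (E.mem_TB_of_mem_ZE (E.hsA w h))
      · exact hW (E.mem_TB_of_mem_ZE (E.hsfine w h))
      · exact hW E.gK_mem_TB
  -- `N ⊆ W ∩ L₁`
  have hNW : C.N ≤ (W.comap (algebraMap L₁ Ω)).toSubring := by
    intro n hn
    refine mem_valuationSubring_of_isIntegral_subring (W.comap (algebraMap L₁ Ω)) ?_ (mem_nrIn_iff.mp hn)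
    rintro _ ⟨a, ha, rfl⟩
    change algebraMap L₁ Ω (algebraMap K L₁ a) ∈ W
    rw [← IsScalarTower.algebraMap_apply]
    exact hA'W ha
  exact hNW hz

/-- **`N ⊆ TB`** (valuative membership + fraction forms over `m°[x′][η]` + normality of `TB`).
[folklore] -/
theorem algebraMap_mem_TB_of_mem_N {z : L₁} (hz : z ∈ C.N) : algebraMap L₁ Ω z ∈ E.TB := by
  haveI := E.isIntegrallyClosed_TB
  have hint : IsIntegral E.TB (algebraMap L₁ Ω z) :=
    isIntegral_of_forall_valuationSubring fun W hW =>
      E.algebraMap_mem_of_mem_N_of_le (fun w hw => hW ⟨w, hw⟩) hz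
  obtain ⟨u, t, hu, hu0, ht, hut⟩ := E.hfrac z
  have hadj : Algebra.adjoin C.Om ({C.x'} : Set Ω) ≤ E.TB :=
    Algebra.adjoin_le (Set.singleton_subset_iff.mpr E.x'_mem_TB)
  refine mem_of_isIntegral_of_mul_mem E.TB hint (hadj hu) hu0 ?_
  rw [hut, Polynomial.eval_eq_sum_range]
  exact E.TB.sum_mem fun i _ => E.TB.mul_mem (hadj (ht i)) (E.TB.pow_mem E.eta_mem_TB i)

/-- **The unit `s_B = f w₀ μ b u` of `TB`.** [folklore] -/
def sB : Ω := C.fΩ * C.w₀ * C.μ * C.b * E.uA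

/-- `s_B ∈ TB`. [folklore] -/
theorem sB_mem_TB : E.sB ∈ E.TB :=
  E.TB.mul_mem (E.TB.mul_mem (E.TB.mul_mem (E.TB.mul_mem (E.mem_TB_of_mem_ZE E.hfZE)
    (E.mem_TB_of_mem_ZE E.hw₀)) E.μ_mem_TB) E.b_mem_TB) E.uA_mem_TB

/-- `|s_B| = 1`. [folklore] -/
theorem valuation_sB : C.V.valuation E.sB = 1 := by
  rw [sB, map_mul, map_mul, map_mul, map_mul, C.valuation_fΩ, C.valuation_w₀, C.valuation_μ, C.hvb,
    E.valuation_uA]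
  simp

/-- `s_B ≠ 0`. [folklore] -/
theorem sB_ne_zero : E.sB ≠ 0 := fun h0 => by
  have h := E.valuation_sB; rw [h0, map_zero] at h; exact zero_ne_one h

/-- The target ring `G = TB[1/s_B]`. [folklore] -/
def G : Subalgebra C.Om Ω := locAway E.TB E.sB E.sB_mem_TB

/-- `TB ≤ G`. [folklore] -/
theorem TB_le_G : E.TB ≤ E.G := le_locAway

/-- Inverting a factor of `s_B`. [folklore] -/
theorem inv_mem_G_of_mul_eq {a r : Ω} (har : a * r = E.sB) (hr : r ∈ E.TB) : a⁻¹ ∈ E.G := by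
  have ha0 : a ≠ 0 := fun h0 => E.sB_ne_zero (by rw [← har, h0, zero_mul])
  have h1 : a⁻¹ = r * E.sB⁻¹ := by
    rw [eq_mul_inv_iff_mul_eq₀ E.sB_ne_zero, ← har, ← mul_assoc, inv_mul_cancel₀ ha0, one_mul]
  rw [h1]
  exact E.G.mul_mem (E.TB_le_G hr) (inv_mem_locAway E.sB_ne_zero)

/-- `f⁻¹ ∈ G`. [folklore] -/
theorem fΩ_inv_mem_G : C.fΩ⁻¹ ∈ E.G :=
  E.inv_mem_G_of_mul_eq (r := C.w₀ * C.μ * C.b * E.uA) (by rw [sB]; ring)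
    (E.TB.mul_mem (E.TB.mul_mem (E.TB.mul_mem (E.mem_TB_of_mem_ZE E.hw₀) E.μ_mem_TB) E.b_mem_TB)
      E.uA_mem_TB)

/-- `w₀⁻¹ = u_D ∈ G`. [folklore] -/
theorem w₀_inv_mem_G : C.w₀⁻¹ ∈ E.G :=
  E.inv_mem_G_of_mul_eq (r := C.fΩ * C.μ * C.b * E.uA) (by rw [sB]; ring)
    (E.TB.mul_mem (E.TB.mul_mem (E.TB.mul_mem (E.mem_TB_of_mem_ZE E.hfZE) E.μ_mem_TB) E.b_mem_TB)
      E.uA_mem_TB)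

/-- `μ⁻¹ ∈ G`. [folklore] -/
theorem μ_inv_mem_G : C.μ⁻¹ ∈ E.G :=
  E.inv_mem_G_of_mul_eq (r := C.fΩ * C.w₀ * C.b * E.uA) (by rw [sB]; ring)
    (E.TB.mul_mem (E.TB.mul_mem (E.TB.mul_mem (E.mem_TB_of_mem_ZE E.hfZE)
      (E.mem_TB_of_mem_ZE E.hw₀)) E.b_mem_TB) E.uA_mem_TB)

/-- `b⁻¹ ∈ G`. [folklore] -/
theorem b_inv_mem_G : C.b⁻¹ ∈ E.G :=
  E.inv_mem_G_of_mul_eq (r := C.fΩ * C.w₀ * C.μ * E.uA) (by rw [sB]; ring)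
    (E.TB.mul_mem (E.TB.mul_mem (E.TB.mul_mem (E.mem_TB_of_mem_ZE E.hfZE)
      (E.mem_TB_of_mem_ZE E.hw₀)) E.μ_mem_TB) E.uA_mem_TB)

/-- `u⁻¹ ∈ G`. [folklore] -/
theorem uA_inv_mem_G : E.uA⁻¹ ∈ E.G :=
  E.inv_mem_G_of_mul_eq (r := C.fΩ * C.w₀ * C.μ * C.b) (by rw [sB]; ring)
    (E.TB.mul_mem (E.TB.mul_mem (E.TB.mul_mem (E.mem_TB_of_mem_ZE E.hfZE)
      (E.mem_TB_of_mem_ZE E.hw₀)) E.μ_mem_TB) E.b_mem_TB)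

/-- `u_D ∈ G`. [folklore] -/
theorem uD_mem_G : C.uD ∈ E.G := by
  rw [eq_inv_of_mul_eq_one_left C.uD_mul_w₀]
  exact E.w₀_inv_mem_G

/-- A localization `B[1/f]` lies in the subring `G` once `B ⊆ G` and `f⁻¹ ∈ G`. [folklore] -/
theorem locAway_subset_G {R : Type u} [CommRing R] [Algebra R Ω] {B : Subalgebra R Ω} {f : Ω}
    {hf : f ∈ B} (hf0 : f ≠ 0) (hB : (B : Set Ω) ⊆ E.G) (hfinv : f⁻¹ ∈ E.G) :
    (locAway B f hf : Set Ω) ⊆ E.G := by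
  intro w hw
  obtain ⟨b₀, hb₀, n, rfl⟩ := (mem_locAway_iff_exists_div (hf := hf) hf0).mp hw
  rw [div_eq_mul_inv, ← inv_pow]
  exact E.G.mul_mem (hB hb₀) (E.G.pow_mem hfinv n)

/-- `N″ ⊆ G`. [folklore] -/
theorem N''_subset_G : (C.N'' : Set Ω) ⊆ E.G := by
  refine E.locAway_subset_G C.fΩ_ne_zero (fun w hw => ?_) E.fΩ_inv_mem_G
  obtain ⟨⟨n, hn⟩, rfl⟩ := Algebra.mem_bot.mp hw
  exact E.TB_le_G (E.algebraMap_mem_TB_of_mem_N hn)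

/-- `G` as an `N″`-subalgebra of `Ω`. [folklore] -/
def GN : Subalgebra C.N'' Ω :=
  { E.G.toSubring with
    algebraMap_mem' := fun r => E.N''_subset_G r.2 }

/-- `T₀ ⊆ G`. [folklore] -/
theorem T₀_subset_G : (C.T₀ : Set Ω) ⊆ E.G := by
  have h : C.T₀ ≤ E.GN := by
    rw [C.T₀_spec.2.2.2.1]
    refine Algebra.adjoin_le ?_
    rintro w (rfl | rfl)
    · change _ ∈ E.G
      rw [← z₀_eq]
      exact E.TB_le_G (E.mem_TB_of_mem_ZE E.hz₀)
    · exact E.uD_mem_G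
  exact fun w hw => h hw

/-- `T₁ ⊆ G`. [folklore] -/
theorem T₁_subset_G : (C.T₁ : Set Ω) ⊆ E.G :=
  E.locAway_subset_G C.μ_ne_zero E.T₀_subset_G E.μ_inv_mem_G

/-- `T ⊆ G`. [folklore] -/
theorem T_subset_G : (C.T : Set Ω) ⊆ E.G :=
  E.locAway_subset_G C.b_ne_zero E.T₁_subset_G E.b_inv_mem_G

/-- **`TA ⊆ TB[1/s_B]`.** [folklore] -/
theorem TA_subset_locAway_TB : (E.TA : Set Ω) ⊆ locAway E.TB E.sB E.sB_mem_TB :=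
  E.locAway_subset_G E.uA_ne_zero E.T_subset_G E.uA_inv_mem_G

end EData

end RelCurveChart

/-! ## Part IV. The roof and the conclusion of Thm. 3.3.1 -/

/-- **Smoothness under an isomorphism of the base.** [folklore] -/
theorem Algebra.Smooth.of_ringEquiv_base {B B' D : Type u} [CommRing B] [CommRing B'] [CommRing D]
    [Algebra B D] [Algebra B' D] (e : B ≃+* B')
    (he : ∀ b : B, algebraMap B' D (e b) = algebraMap B D b) [Algebra.Smooth B D] :
    Algebra.Smooth B' D := by
  letI algB'B : Algebra B' B := e.symm.toRingHom.toAlgebra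
  haveI : IsScalarTower B' B D := IsScalarTower.of_algebraMap_eq fun b' => by
    change algebraMap B' D b' = algebraMap B D (e.symm b')
    rw [← he, RingEquiv.apply_symm_apply]
  haveI : Algebra.Smooth B' B' := ⟨inferInstance, inferInstance⟩
  let e' : B' ≃ₐ[B'] B :=
    { e.symm with
      commutes' := fun _ => rfl }
  haveI : Algebra.Smooth B' B := Algebra.Smooth.of_equiv e'
  exact Algebra.Smooth.comp B' B D

namespace RelCurveChart

variable {k K L₁ Ω : Type u} [Field k] [Field K] [Field L₁] [Field Ω]
  [Algebra k K] [Algebra K L₁] [Algebra k L₁] [IsScalarTower k K L₁]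
  [Algebra L₁ Ω] [Algebra K Ω] [Algebra k Ω] [IsScalarTower K L₁ Ω] [IsScalarTower k L₁ Ω]
  [IsAlgClosed Ω] [FiniteDimensional K L₁] (C : RelCurveChart k K L₁ Ω)

/-- `k` acts on the constant field `m ⊆ Ω`. [folklore] -/
instance algebra_k_m : Algebra k C.m :=
  ((algebraMap k Ω).codRestrict C.m.toSubring fun c => C.kΩ_le_m ⟨c, rfl⟩).toAlgebra

/-- The action is the inclusion. [folklore] -/
theorem algebraMap_k_m_apply (c : k) : ((algebraMap k C.m c : C.m) : Ω) = algebraMap k Ω c := rfl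

/-- `k → m → Ω` is `k → Ω`. [folklore] -/
instance isScalarTower_k_m : IsScalarTower k C.m Ω :=
  IsScalarTower.of_algebraMap_eq fun _ => rfl

/-- The valuation ring `m° = O_V ∩ m` of the constant field. [folklore] -/
def OmV : ValuationSubring C.m := C.V.comap (algebraMap C.m Ω)

/-- `m°` induces `k°`. [folklore] -/
theorem OmV_comap : C.OmV.comap (algebraMap k C.m) = C.Ok := by
  rw [OmV, ValuationSubring.comap_comap, ← IsScalarTower.algebraMap_eq, C.comap_k]

/-- The subring `O_V ∩ m` of `Ω` is the valuation ring `m°` of `m`. [folklore] -/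
def eOm : C.Om ≃+* C.OmV :=
  { toFun := fun z => ⟨⟨z.1, (C.mem_Om_iff.mp z.2).2⟩, (C.mem_Om_iff.mp z.2).1⟩
    invFun := fun w => ⟨(w.1 : Ω), C.mem_Om_iff.mpr ⟨w.2, w.1.2⟩⟩
    left_inv := fun _ => rfl
    right_inv := fun _ => rfl
    map_mul' := fun _ _ => rfl
    map_add' := fun _ _ => rfl }

/-- `k° → N`. [folklore] -/
theorem algebraMap_mem_N_of_mem_Ok (c : C.Ok) : algebraMap k L₁ c ∈ C.N := by
  rw [IsScalarTower.algebraMap_apply k K L₁]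
  exact C.algebraMap_mem_N (C.R₀_le_A' ⟨c, c.2, rfl⟩)

/-- `k° → m°`. [folklore] -/
theorem algebraMap_mem_OmV_of_mem_Ok (c : C.Ok) : algebraMap k C.m c ∈ C.OmV := by
  have : (c : k) ∈ C.OmV.comap (algebraMap k C.m) := by rw [C.OmV_comap]; exact c.2
  exact this

/-- The structure map `k° → N`. [folklore] -/
def fN : C.Ok →+* C.N := ((algebraMap k L₁).comp C.Ok.subtype).codRestrict C.N C.algebraMap_mem_N_of_mem_Ok

/-- The structure map `k° → m°`. [folklore] -/
def gOm : C.Ok →+* C.OmV :=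
  ((algebraMap k C.m).comp C.Ok.subtype).codRestrict C.OmV C.algebraMap_mem_OmV_of_mem_Ok

namespace EData

variable {C} (E : EData C)

/-- `TB` over the valuation ring `m°` of `m` (same subring of `Ω`). [folklore] -/
def TB' : Subalgebra C.OmV Ω :=
  { E.TB.toSubring with
    algebraMap_mem' := fun c => E.mem_TB_of_mem_Om (C.eOm.symm c).2 }

/-- `TB′` is smooth over `m°`. [folklore] -/
theorem smooth_TB' : Algebra.Smooth C.OmV E.TB' := by
  haveI : Algebra.Smooth C.Om E.TB := E.smooth_TB
  letI : Algebra C.Om E.TB' := (inferInstance : Algebra C.Om E.TB)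
  haveI : Algebra.Smooth C.Om E.TB' := E.smooth_TB
  exact Algebra.Smooth.of_ringEquiv_base (D := E.TB') C.eOm fun b => Subtype.ext rfl

/-- `TA` over `N`. [folklore] -/
def TA' : Subalgebra C.N Ω := E.TA.restrictScalars C.N

/-- `TA′` is smooth over `N`. [folklore] -/
theorem smooth_TA' : Algebra.Smooth C.N E.TA' := by
  haveI : Algebra.Smooth C.N C.N'' := C.smooth_N''
  haveI := E.etale_TA
  haveI : Algebra.FormallyEtale C.N'' E.TA := E.etale_TA.formallyEtale
  haveI : Algebra.FinitePresentation C.N'' E.TA := E.etale_TA.finitePresentation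
  haveI : Algebra.Smooth C.N'' E.TA := ⟨inferInstance, inferInstance⟩
  have h : Algebra.Smooth C.N E.TA := Algebra.Smooth.comp C.N C.N'' E.TA
  exact h

end EData

/-- **The roof**: `(Spec N, centre of L₁°)` and `(Spec m°, closed point)` are smooth-equivalent
over `k°`. [cite: Temkin2013, Thm. 3.3.1 (proof, Step 4)] -/
theorem areSmoothEquivalent (E : EData C) :
    AreSmoothEquivalent C.fN C.gOm
      ((maximalIdeal C.O₁).comap (Subring.inclusion C.N_le_O₁)) (maximalIdeal C.OmV) := by
  haveI := E.smooth_TA'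
  haveI := E.smooth_TB'
  refine AreSmoothEquivalent.of_charts C.fN C.gOm (RingHom.ext fun c => ?_) C.V
    (fun a => mem_comap_maximalIdeal_iff_valuation_lt_one_of_comap_eq C.V (algebraMap L₁ Ω) C.O₁
      C.hV C.N_le_O₁ a)
    (fun b => mem_maximalIdeal_iff_valuation_lt_one_of_comap_eq C.V (algebraMap C.m Ω) C.OmV rfl b)
    E.TA' E.TB' E.TA_le_V (sA := E.D) (sB := E.sB) E.D_mem_TA E.sB_mem_TB E.valuation_D
    E.valuation_sB (fun w hw => E.TB_subset_locAway_TA hw) (fun w hw => E.TA_subset_locAway_TB hw)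
  change algebraMap L₁ Ω (algebraMap k L₁ c) = ((algebraMap k C.m c : C.m) : Ω)
  rw [← IsScalarTower.algebraMap_apply, algebraMap_k_m_apply]


/-! ### The conclusion of Thm. 3.3.1 for the datum -/

/-- `m ≅ k(y₀)` as `k`-algebras. [folklore] -/
def mEquivAdjoin : C.m ≃ₐ[k] IntermediateField.adjoin k ({C.y₀} : Set Ω) :=
  { RingEquiv.subringCongr (congrArg Subfield.toSubring C.hm) with
    commutes' := fun _ => Subtype.ext rfl }

/-- `m` is finite over `k`. [folklore] -/
instance finiteDimensional_k_m : FiniteDimensional k C.m := by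
  haveI : FiniteDimensional k (IntermediateField.adjoin k ({C.y₀} : Set Ω)) :=
    IntermediateField.adjoin.finiteDimensional C.hy₀int
  exact LinearEquiv.finiteDimensional C.mEquivAdjoin.symm.toLinearEquiv

/-- `m` is separable over `k`. [folklore] -/
instance isSeparable_k_m : Algebra.IsSeparable k C.m := by
  haveI : Algebra.IsSeparable k (IntermediateField.adjoin k ({C.y₀} : Set Ω)) :=
    (IntermediateField.isSeparable_adjoin_simple_iff_isSeparable _ _).2 C.hy₀sep
  exact AlgEquiv.Algebra.isSeparable C.mEquivAdjoin.symm

/-- The trivial purely inseparable constants `l = k` as `⊥ ⊆ L₁`, acting on `m`. [folklore] -/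
instance algebra_bot_m : Algebra (⊥ : IntermediateField k L₁) C.m :=
  ((algebraMap k C.m).comp (algebraMap (⊥ : IntermediateField k L₁) k)).toAlgebra

/-- `k → ⊥ → m` is `k → m`. [folklore] -/
instance isScalarTower_k_bot_m : IsScalarTower k (⊥ : IntermediateField k L₁) C.m :=
  IsScalarTower.of_algebraMap_eq fun c => by
    change algebraMap k C.m c =
      algebraMap k C.m (algebraMap (⊥ : IntermediateField k L₁) k (algebraMap k _ c))
    rw [IntermediateField.coe_algebraMap_over_bot, IntermediateField.botEquiv_def]

/-- `⊥ → k → m` tower. [folklore] -/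
instance isScalarTower_bot_k_m : IsScalarTower (⊥ : IntermediateField k L₁) k C.m :=
  IsScalarTower.of_algebraMap_eq fun _ => rfl

/-- **Thm. 3.3.1 (smooth-fibre case) for a chart datum with E-data.** The conclusion of
`Temkin2013RelativeCurve` for `(k, K, k°, K°, A, L₁, L₁°)`, with the trivial purely inseparable
extensions (`L₁′ = L₁`, `l = k`), the constants `m = k(y₀)`, and `N = Nr_{L₁}(A′)`.
[cite: Temkin2013, Thm. 3.3.1] -/
theorem conclusion (E : EData C) : Temkin2013RelativeCurveConclusion k K C.Ok C.O C.A L₁ C.O₁ := by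
  refine ⟨C.A', C.A_le_A', C.A'_model, L₁, inferInstance, Algebra.id L₁, inferInstance, inferInstance,
    inferInstance, inferInstance, inferInstance, inferInstance, ⊥, inferInstance, inferInstance, ?_,
    C.O₁, ?_, C.m, inferInstance, inferInstance, inferInstance, inferInstance, ?_, ?_, C.OmV, ?_,
    C.N, C.N_le_O₁, coe_nrIn _, C.algebraMap_mem_N_of_mem_Ok, C.algebraMap_mem_OmV_of_mem_Ok,
    C.areSmoothEquivalent E⟩
  · -- `L₁[⊥] = L₁`
    exact eq_top_iff.mpr fun x _ => (Algebra.adjoin L₁ _).algebraMap_mem x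
  · -- `O₁.comap id = O₁`
    ext x; exact Iff.rfl
  · -- `m` finite over `⊥ ≅ k`
    exact Module.Finite.of_restrictScalars_finite k _ _
  · -- `m` separable over `⊥ ≅ k`
    exact Algebra.isSeparable_tower_top_of_isSeparable k _ _
  · -- `m°` and `L₁°` induce the same valuation ring on `⊥ ≅ k`
    ext c
    obtain ⟨c₀, rfl⟩ : ∃ c₀ : k, algebraMap k _ c₀ = c :=
      ⟨IntermediateField.botEquiv k L₁ c, by
        rw [← IntermediateField.botEquiv_symm, AlgEquiv.symm_apply_apply]⟩
    rw [ValuationSubring.mem_comap, ValuationSubring.mem_comap,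
      ← IsScalarTower.algebraMap_apply, ← IsScalarTower.algebraMap_apply]
    have h1 : algebraMap k C.m c₀ ∈ C.OmV ↔ c₀ ∈ C.Ok := by
      rw [← ValuationSubring.mem_comap, C.OmV_comap]
    have h2 : algebraMap k L₁ c₀ ∈ C.O₁ ↔ c₀ ∈ C.Ok := by
      rw [← ValuationSubring.mem_comap, IsScalarTower.algebraMap_eq k K L₁,
        ← ValuationSubring.comap_comap, C.hO₁, C.hO]
    rw [h1, h2]

end RelCurveChart

/-! ### The reduction of the smooth-fibre case of Thm. 3.3.1 to chart data -/

/-- **Reduction.** `Temkin2013RelativeCurveSmoothFibre` follows as soon as every instance of its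
data carries a chart datum with E-data (inside some algebraically closed valued field over `K₁`)
— the valuation-theoretic content of Temkin's Steps 2–3 (henselian generation with constants in
the henselization, the deep `m`-rational disc with its `K`-rational cut-out, the local-étale form
with Kaplansky unit forms). [cite: Temkin2013, Thm. 3.3.1 (proof, Steps 2–4)] -/
theorem Temkin2013RelativeCurveSmoothFibre.of_chartData
    (h : ∀ (k K : Type u) [Field k] [Field K] [Algebra k K]
      (Ok : ValuationSubring k) (O : ValuationSubring K),
      ringChar (IsLocalRing.ResidueField Ok) = ringChar k →
      O.comap (algebraMap k K) = Ok → ringKrullDim Ok = 1 → ringKrullDim O = 1 →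
      (⊤ : IntermediateField k K).FG → Algebra.trdeg k K = 1 →
      IsValueTorsionOver O (algebraMap k K).fieldRange ⊤ →
      IsResiduallyAlgebraicOver O (algebraMap k K).fieldRange ⊤ →
      ∀ A : Subring K, IsAffineNormalizedModel O (Ok.toSubring.map (algebraMap k K)) A →
        Algebra.Smooth k (Algebra.adjoin k (A : Set K)) →
      ∀ (K₁ : Type u) [Field K₁] [Algebra K K₁] [Algebra k K₁] [IsScalarTower k K K₁],
        FiniteDimensional K K₁ →
      ∀ O₁ : ValuationSubring K₁, O₁.comap (algebraMap K K₁) = O →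
        Algebra.Smooth k (Algebra.adjoin k (nrIn (A.map (algebraMap K K₁)) : Set K₁)) →
      ∃ (Ω : Type u) (_ : Field Ω) (_ : Algebra K₁ Ω) (_ : Algebra K Ω) (_ : Algebra k Ω)
        (_ : IsScalarTower K K₁ Ω) (_ : IsScalarTower k K₁ Ω) (_ : IsAlgClosed Ω)
        (_ : FiniteDimensional K K₁)
        (C : RelCurveChart k K K₁ Ω) (_ : C.EData), C.Ok = Ok ∧ C.O = O ∧ C.A = A ∧ C.O₁ = O₁) :
    Temkin2013RelativeCurveSmoothFibre.{u} := by
  intro k K _ _ _ Ok O h1 h2 h3 h4 h5 h6 h7 h8 A hA hsm K₁ _ _ _ _ hK₁ O₁ hO₁ hsm₁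
  haveI := hK₁
  obtain ⟨Ω, _, _, _, _, _, _, _, _, C, E, hOk, hO, hAeq, hO₁eq⟩ :=
    h k K Ok O h1 h2 h3 h4 h5 h6 h7 h8 A hA hsm K₁ hK₁ O₁ hO₁ hsm₁
  rw [← hOk, ← hO, ← hAeq, ← hO₁eq]
  exact C.conclusion E


end Literature.AlgebraicGeometry.Resolution

end
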